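import Mathlib.Analysis.Meromorphic.Order
import Mathlib.Analysis.SpecialFunctions.Pow.Deriv
import Mathlib.Analysis.SpecialFunctions.Complex.Log
import Mathlib.Analysis.Complex.RemovableSingularity
import HarnessLib

/-!
# Pick engine helper (line `pick-half-plane`, stub `stub_pickEngine`): the root order `5/4`

Support file for crux `BoundaryClosureR` (stmt-CriticalPhenomena-14004), line `pick-half-plane`,
stub `stub_pickEngine`, STAGE 2 at a pinned flat root `x`: the complex-analysis step turning the
one-sided Pick data into the exact blow-up order of the limit density.  After the two-arm
reflection (`…PickEngineTwoArm`) the normalised developing map reads `h - p = e^{iθ} (z-x)^{-1/4} G`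
with `G` holomorphic on the punctured disc; on the upper half-disc `U = {im z > im x} ∩ B(x, r)`
the function `φ = (z - x)^{-1/4} G` (principal branch) lies in a closed half-plane
`{w | -M ≤ re (ω̄ w)}` (root wedge of `HalfPlaneBounds` (ii)) and is unbounded at `x` from inside
`U` (arm divergence, `GateMassLaws` (b)).
* `exists_angle_re_neg` — an arc of directions of length `Lπ > π` leaves every half-plane;
* `root_order_of_meromorphicAt` — if `G` is MEROMORPHIC at `x`, it has a removable singularity
  with nonzero value (poles leave the half-plane along a ray, zeros contradict divergence);
* `tendsto_deriv_mul_cpow_five_fourths` — then `φ'(z) (z - x)^{5/4} → -G(x)/4` inside `U`;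
* `pickEngine_rootOrder` — export (registered sub-goal of `stub_pickEngine`).
NOT here (reported missing): excluding an ESSENTIAL singularity of `G` from the half-plane
condition alone, and the lattice-to-continuum boundary regularity on the arms.  References:
Ahlfors, *Complex Analysis* (1979), Ch. 4 §3.2; Mathlib `MeromorphicAt`, `Complex.cpow`.
-/

noncomputable section

open scoped Topology ComplexConjugate
open Filter Set Metric Complex

namespace Summit.CriticalPhenomena.SAWScalingLimit.Theorems.PickHalfPlane.Engine

/-- Advancing the direction by `π/L` flips the sign of `re (c e^{-iLθ})`. [folklore] -/
theorem re_mul_exp_add_pi_div (c : ℂ) {L : ℝ} (hL : L ≠ 0) (θ : ℝ) :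
    (c * exp (-((L * (θ + Real.pi / L) : ℝ) : ℂ) * I)).re =
      -(c * exp (-((L * θ : ℝ) : ℂ) * I)).re := by
  have h : L * (θ + Real.pi / L) = L * θ + Real.pi := by field_simp
  rw [h, show -((L * θ + Real.pi : ℝ) : ℂ) * I = -((L * θ : ℝ) : ℂ) * I + -(Real.pi * I) by
    push_cast; ring, Complex.exp_add, Complex.exp_neg_pi_mul_I]
  simp

/-- The value of `re (c e^{-ia})` in coordinates: `re c · cos a + im c · sin a`. [folklore] -/
theorem re_mul_exp_neg_mul_I (c : ℂ) (a : ℝ) :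
    (c * exp (-(a : ℂ) * I)).re = c.re * Real.cos a + c.im * Real.sin a := by
  rw [show -(a : ℂ) * I = ((-a : ℝ) : ℂ) * I by push_cast; ring, Complex.exp_mul_I]
  simp only [mul_re, add_re, mul_im, add_im, I_re, I_im, mul_zero, mul_one, zero_add, add_zero,
    sub_zero, Complex.cos_ofReal_re, Complex.sin_ofReal_re, Complex.cos_ofReal_im,
    Complex.sin_ofReal_im, Real.cos_neg, Real.sin_neg]
  ring

/-- **An arc of directions longer than `π` leaves every half-plane.** For `c ≠ 0` and `L > 1`
there is `θ ∈ (0, π)` with `re (c e^{-iLθ}) < 0`: the directions `c e^{-iLθ}`, `θ ∈ (0, π)`,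
form an open arc of length `Lπ > π`, which no closed half-plane through `0` contains.
(Explicit choice: with `θₐ = (π - π/L)/2`, one of `θₐ`, `θₐ + π/L`, `θₐ + ε`, `θₐ + ε + π/L`
works, `ε = min θₐ (π/L) / 2`.) [folklore] -/
theorem exists_angle_re_neg {c : ℂ} (hc : c ≠ 0) {L : ℝ} (hL : 1 < L) :
    ∃ θ : ℝ, 0 < θ ∧ θ < Real.pi ∧ (c * exp (-((L * θ : ℝ) : ℂ) * I)).re < 0 := by
  have hπ := Real.pi_pos
  have hL0 : 0 < L := by linarith
  have hπL : 0 < Real.pi / L := div_pos hπ hL0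
  have hπL' : Real.pi / L < Real.pi := by
    rw [div_lt_iff₀ hL0]; nlinarith
  set θa : ℝ := (Real.pi - Real.pi / L) / 2 with hθa
  have hθa0 : 0 < θa := by rw [hθa]; linarith
  have hθaπ : θa + Real.pi / L < Real.pi := by rw [hθa]; linarith
  set f : ℝ → ℝ := fun θ => (c * exp (-((L * θ : ℝ) : ℂ) * I)).re with hf
  have hflip : ∀ θ, f (θ + Real.pi / L) = -f θ := fun θ => re_mul_exp_add_pi_div c hL0.ne' θ
  rcases lt_trichotomy (f θa) 0 with hneg | hzero | hpos
  · exact ⟨θa, hθa0, by linarith, hneg⟩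
  · -- `w = c e^{-iLθₐ}` is purely imaginary and nonzero; nudge the direction by `ε`
    set ε : ℝ := min θa (Real.pi / L) / 2 with hε
    have hε0 : 0 < ε := by rw [hε]; positivity
    have hεθ : ε < θa := by
      rw [hε]; linarith [min_le_left θa (Real.pi / L)]
    have hεL : L * ε < Real.pi := by
      have : ε < Real.pi / L := by rw [hε]; linarith [min_le_right θa (Real.pi / L)]
      calc L * ε < L * (Real.pi / L) := by gcongr
        _ = Real.pi := by field_simp
    set w : ℂ := c * exp (-((L * θa : ℝ) : ℂ) * I) with hw
    have hwre : w.re = 0 := hzero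
    have hw0 : w ≠ 0 := mul_ne_zero hc (Complex.exp_ne_zero _)
    have hwim : w.im ≠ 0 := by
      intro him; exact hw0 (Complex.ext (by simp [hwre]) (by simp [him]))
    have hsin : 0 < Real.sin (L * ε) := Real.sin_pos_of_pos_of_lt_pi (by positivity) hεL
    have hval : f (θa + ε) = w.im * Real.sin (L * ε) := by
      have : -((L * (θa + ε) : ℝ) : ℂ) * I = -((L * θa : ℝ) : ℂ) * I + -((L * ε : ℝ) : ℂ) * I := by
        push_cast; ring
      simp only [hf]
      rw [this, Complex.exp_add, ← mul_assoc, ← hw, re_mul_exp_neg_mul_I, hwre, zero_mul, zero_add]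
    rcases lt_or_gt_of_ne hwim with him | him
    · refine ⟨θa + ε, by linarith, by linarith, ?_⟩
      show f (θa + ε) < 0
      rw [hval]; exact mul_neg_of_neg_of_pos him hsin
    · refine ⟨θa + ε + Real.pi / L, by linarith, by linarith, ?_⟩
      show f (θa + ε + Real.pi / L) < 0
      rw [hflip, hval]; exact neg_neg_of_pos (mul_pos him hsin)
  · refine ⟨θa + Real.pi / L, by linarith, hθaπ, ?_⟩
    show f (θa + Real.pi / L) < 0
    rw [hflip]; linarith

/-- The point at distance `t > 0` in direction `θ` from `0` is `exp (log t + iθ)`. [folklore] -/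
theorem ray_eq_exp {t : ℝ} (ht : 0 < t) (θ : ℝ) :
    (t : ℂ) * exp ((θ : ℂ) * I) = exp ((Real.log t : ℂ) + (θ : ℂ) * I) := by
  rw [Complex.exp_add, ← Complex.ofReal_exp, Real.exp_log ht]

/-- Complex powers along a ray with direction `θ ∈ (-π, π]` are computed by the principal
logarithm: `(t e^{iθ}) ^ s = exp ((log t + iθ) s)`. [folklore] -/
theorem ray_cpow {t θ : ℝ} (ht : 0 < t) (hθ₁ : -Real.pi < θ) (hθ₂ : θ ≤ Real.pi) (s : ℂ) :
    ((t : ℂ) * exp ((θ : ℂ) * I)) ^ s = exp (((Real.log t : ℂ) + (θ : ℂ) * I) * s) := by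
  rw [ray_eq_exp ht, cpow_def_of_ne_zero (Complex.exp_ne_zero _), Complex.log_exp]
  · simpa using hθ₁
  · simpa using hθ₂

/-- Integer powers along a ray: `(t e^{iθ}) ^ n = exp (n (log t + iθ))`. [folklore] -/
theorem ray_zpow {t : ℝ} (ht : 0 < t) (θ : ℝ) (n : ℤ) :
    ((t : ℂ) * exp ((θ : ℂ) * I)) ^ n = exp (n * ((Real.log t : ℂ) + (θ : ℂ) * I)) := by
  rw [ray_eq_exp ht, Complex.exp_int_mul]

/-- The leading term along the ray of direction `θ`: with `L = m + 5/4`,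
`ω̄ (t e^{iθ})^{-1/4} (t e^{iθ})^{-(m+1)} v = exp (-L log t) · (ω̄ v e^{-iLθ})`. [folklore] -/
theorem ray_leading_term {t θ : ℝ} (ht : 0 < t) (hθ₁ : -Real.pi < θ) (hθ₂ : θ ≤ Real.pi)
    (m : ℕ) (ω v : ℂ) :
    (starRingEnd ℂ) ω * (((t : ℂ) * exp ((θ : ℂ) * I)) ^ (-(1 / 4 : ℂ)) *
        (((t : ℂ) * exp ((θ : ℂ) * I)) ^ (-((m : ℤ) + 1)) * v)) =
      ((Real.exp (-(((m : ℝ) + 5 / 4) * Real.log t)) : ℝ) : ℂ) *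
        ((starRingEnd ℂ) ω * v * exp (-((((m : ℝ) + 5 / 4) * θ : ℝ) : ℂ) * I)) := by
  rw [ray_cpow ht hθ₁ hθ₂, ray_zpow ht, Complex.ofReal_exp]
  have key : exp (((Real.log t : ℂ) + (θ : ℂ) * I) * (-(1 / 4 : ℂ))) *
      exp (((-((m : ℤ) + 1) : ℤ) : ℂ) * ((Real.log t : ℂ) + (θ : ℂ) * I)) =
      exp (((-(((m : ℝ) + 5 / 4) * Real.log t) : ℝ) : ℂ)) *
        exp (-((((m : ℝ) + 5 / 4) * θ : ℝ) : ℂ) * I) := by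
    rw [← Complex.exp_add, ← Complex.exp_add]
    congr 1
    push_cast
    ring
  calc (starRingEnd ℂ) ω * (exp (((Real.log t : ℂ) + (θ : ℂ) * I) * (-(1 / 4 : ℂ))) *
        (exp (((-((m : ℤ) + 1) : ℤ) : ℂ) * ((Real.log t : ℂ) + (θ : ℂ) * I)) * v))
      = (exp (((Real.log t : ℂ) + (θ : ℂ) * I) * (-(1 / 4 : ℂ))) *
          exp (((-((m : ℤ) + 1) : ℤ) : ℂ) * ((Real.log t : ℂ) + (θ : ℂ) * I))) *
          ((starRingEnd ℂ) ω * v) := by ring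
    _ = _ := by rw [key]; ring

/-- **Root order from meromorphy, the half-plane condition and divergence.** Let `G` be
meromorphic at `x` (removable singularity, pole, but no essential singularity) and put
`φ(z) = (z - x)^{-1/4} G(z)` (principal branch) on the upper half-disc
`U = {im z > im x} ∩ B(x, r)`. If `φ(U)` lies in a closed half-plane `{w | -M ≤ re (ω̄ w)}`
(`|ω| = 1`) and `φ` is unbounded at `x` from inside `U`, then `G` has a removable singularity at
`x` with a nonzero value: `G` agrees near `x` (punctured) with a function `g` analytic at `x`,
`g x ≠ 0`. Poles of order `m ≥ 1` are excluded because the leading term `(z - x)^{-m-1/4}`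
sweeps an arc of directions of length `(m + 1/4)π > π` as `arg (z - x)` runs through `(0, π)`
(`exists_angle_re_neg`), leaving the half-plane; zeros (and `G ≡ 0`) are excluded because then
`φ = O(|z - x|^{3/4})` is bounded near `x` (Ahlfors 1979, Ch. 4 §3.2). [folklore] -/
theorem root_order_of_meromorphicAt {x ω : ℂ} {r M : ℝ} {G : ℂ → ℂ}
    (hmer : MeromorphicAt G x)
    (hhalf : ∀ z ∈ {z : ℂ | x.im < z.im} ∩ ball x r,
      -M ≤ ((starRingEnd ℂ) ω * ((z - x) ^ (-(1 / 4 : ℂ)) * G z)).re)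
    (hω : ‖ω‖ = 1) (hr : 0 < r)
    (hdiv : ∀ A : ℝ, ∃ᶠ z in 𝓝[{z : ℂ | x.im < z.im} ∩ ball x r] x,
      A ≤ ‖(z - x) ^ (-(1 / 4 : ℂ)) * G z‖) :
    ∃ g : ℂ → ℂ, AnalyticAt ℂ g x ∧ g x ≠ 0 ∧ G =ᶠ[𝓝[≠] x] g := by
  set U : Set ℂ := {z : ℂ | x.im < z.im} ∩ ball x r with hU
  have hUx : U ⊆ {x}ᶜ := by
    rintro z ⟨hz, -⟩ rfl
    simp at hz
  have hle : 𝓝[U] x ≤ 𝓝[≠] x := nhdsWithin_mono x hUx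
  -- (1) `G` is not identically zero near `x`
  have hnot_top : meromorphicOrderAt G x ≠ ⊤ := by
    intro htop
    rw [meromorphicOrderAt_eq_top_iff] at htop
    have hev : ∀ᶠ z in 𝓝[U] x, ‖(z - x) ^ (-(1 / 4 : ℂ)) * G z‖ < 1 := by
      filter_upwards [hle htop] with z hz
      simp [hz]
    obtain ⟨z, hz1, hz2⟩ := ((hdiv 1).and_eventually hev).exists
    linarith
  obtain ⟨g, hg, hg0, hrep⟩ := (meromorphicOrderAt_ne_top_iff hmer).1 hnot_top
  set n : ℤ := (meromorphicOrderAt G x).untop₀ with hn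
  -- (2) the order is not positive: otherwise `φ → 0` at `x` inside `U`
  have hn_nonpos : n ≤ 0 := by
    by_contra hpos
    have hpos : 0 < n := lt_of_not_ge hpos
    obtain ⟨k, hk⟩ : ∃ k : ℕ, n = (k : ℤ) + 1 := ⟨(n - 1).toNat, by omega⟩
    -- `φ z = (z - x)^{3/4} · ((z - x)^k g z)` near `x` inside `U`
    have hφ : ∀ᶠ z in 𝓝[U] x, (z - x) ^ (-(1 / 4 : ℂ)) * G z =
        (z - x) ^ ((3 / 4 : ℂ)) * ((z - x) ^ k * g z) := by
      filter_upwards [hle hrep, self_mem_nhdsWithin] with z hz hzU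
      have hzx : z - x ≠ 0 := sub_ne_zero.2 (hUx hzU)
      rw [hz, hk, smul_eq_mul, show (3 / 4 : ℂ) = -(1 / 4 : ℂ) + 1 by norm_num,
        cpow_add _ _ hzx, cpow_one, zpow_add₀ hzx, zpow_natCast, zpow_one]
      ring
    have h34 : Tendsto (fun z : ℂ => (z - x) ^ ((3 / 4 : ℂ))) (𝓝[U] x) (𝓝 0) := by
      rw [tendsto_zero_iff_norm_tendsto_zero]
      have h1 : Tendsto (fun z : ℂ => ‖z - x‖) (𝓝 x) (𝓝 0) := by
        have := ((continuous_id.sub continuous_const).norm : Continuous fun z : ℂ => ‖z - x‖).tendsto x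
        simpa using this
      have h2 : Tendsto (fun s : ℝ => s ^ (3 / 4 : ℝ)) (𝓝 0) (𝓝 0) := by
        have := (Real.continuousAt_rpow_const 0 (3 / 4 : ℝ) (Or.inr (by norm_num))).tendsto
        simpa [Real.zero_rpow (show (3 / 4 : ℝ) ≠ 0 by norm_num)] using this
      refine ((h2.comp h1).mono_left nhdsWithin_le_nhds).congr' ?_
      filter_upwards with z
      simp only [Function.comp_apply]
      rw [show ((3 / 4 : ℂ)) = ((3 / 4 : ℝ) : ℂ) by push_cast; ring, norm_cpow_real]
    have hrest : Tendsto (fun z : ℂ => (z - x) ^ k * g z) (𝓝[U] x) (𝓝 ((x - x) ^ k * g x)) :=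
      ((((continuous_id.sub continuous_const).pow k).continuousAt.tendsto).mul
        hg.continuousAt.tendsto).mono_left nhdsWithin_le_nhds
    have hlim : Tendsto (fun z : ℂ => (z - x) ^ (-(1 / 4 : ℂ)) * G z) (𝓝[U] x) (𝓝 0) := by
      have := h34.mul hrest
      rw [zero_mul] at this
      exact this.congr' (hφ.mono fun z hz => hz.symm)
    have hev : ∀ᶠ z in 𝓝[U] x, ‖(z - x) ^ (-(1 / 4 : ℂ)) * G z‖ < 1 := by
      have := (tendsto_zero_iff_norm_tendsto_zero.1 hlim).eventually (gt_mem_nhds one_pos)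
      exact this
    obtain ⟨z, hz1, hz2⟩ := ((hdiv 1).and_eventually hev).exists
    linarith
  -- (3) the order is not negative: a pole leaves the half-plane along a well-chosen ray
  have hn_nonneg : 0 ≤ n := by
    by_contra hneg
    have hneg : n < 0 := lt_of_not_ge hneg
    obtain ⟨m, hm⟩ : ∃ m : ℕ, n = -((m : ℤ) + 1) := ⟨(-n - 1).toNat, by omega⟩
    set L : ℝ := (m : ℝ) + 5 / 4 with hL
    have hL1 : 1 < L := by rw [hL]; linarith [m.cast_nonneg (α := ℝ)]
    have hc : (starRingEnd ℂ) ω * g x ≠ 0 := by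
      refine mul_ne_zero ?_ hg0
      rw [map_ne_zero]
      rintro rfl
      simp at hω
    obtain ⟨θ, hθ0, hθπ, hθneg⟩ := exists_angle_re_neg hc hL1
    -- the ray `zt t = x + t e^{iθ}`
    set zt : ℝ → ℂ := fun t => x + (t : ℂ) * exp ((θ : ℂ) * I) with hzt
    have hzt_sub : ∀ t, zt t - x = (t : ℂ) * exp ((θ : ℂ) * I) := fun t => by
      simp [hzt]
    have hzt_tend : Tendsto zt (𝓝[>] 0) (𝓝 x) := by
      have : Tendsto zt (𝓝 0) (𝓝 (x + ((0 : ℝ) : ℂ) * exp ((θ : ℂ) * I))) :=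
        ((Complex.continuous_ofReal.tendsto 0).mul tendsto_const_nhds).const_add x
      simpa using this.mono_left nhdsWithin_le_nhds
    have hzt_U : ∀ᶠ t in 𝓝[>] (0 : ℝ), zt t ∈ U := by
      filter_upwards [Ioo_mem_nhdsGT hr] with t ht
      refine ⟨?_, ?_⟩
      · show x.im < (zt t).im
        have : (zt t).im = x.im + t * Real.sin θ := by
          simp only [hzt, add_im, mul_im, Complex.ofReal_re, Complex.ofReal_im,
            Complex.exp_ofReal_mul_I_im, Complex.exp_ofReal_mul_I_re, zero_mul, add_zero]
        rw [this]
        have := Real.sin_pos_of_pos_of_lt_pi hθ0 hθπ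
        nlinarith [ht.1]
      · rw [mem_ball, dist_eq_norm, hzt_sub, norm_mul, Complex.norm_real, Real.norm_eq_abs,
          abs_of_pos ht.1, Complex.norm_exp_ofReal_mul_I, mul_one]
        exact ht.2
    have hzt_ne : Tendsto zt (𝓝[>] 0) (𝓝[≠] x) :=
      tendsto_nhdsWithin_iff.2 ⟨hzt_tend, hzt_U.mono fun t ht => hUx ht⟩
    -- along the ray: `G = (· - x)^n g`, `g → g x`, and the real factor blows up
    have hrep_t : ∀ᶠ t in 𝓝[>] (0 : ℝ), G (zt t) = (zt t - x) ^ n • g (zt t) :=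
      hzt_ne.eventually hrep
    have hg_t : Tendsto (fun t => ((starRingEnd ℂ) ω * g (zt t) *
        exp (-(((L * θ : ℝ)) : ℂ) * I)).re) (𝓝[>] 0)
        (𝓝 (((starRingEnd ℂ) ω * g x * exp (-(((L * θ : ℝ)) : ℂ) * I)).re)) := by
      have hgc : Tendsto (fun t => g (zt t)) (𝓝[>] 0) (𝓝 (g x)) :=
        hg.continuousAt.tendsto.comp hzt_tend
      exact (Complex.continuous_re.tendsto _).comp
        ((tendsto_const_nhds.mul hgc).mul tendsto_const_nhds)
    set η : ℝ := -((starRingEnd ℂ) ω * g x * exp (-(((L * θ : ℝ)) : ℂ) * I)).re / 2 with hη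
    have hη0 : 0 < η := by rw [hη]; linarith
    have hg_ev : ∀ᶠ t in 𝓝[>] (0 : ℝ), ((starRingEnd ℂ) ω * g (zt t) *
        exp (-(((L * θ : ℝ)) : ℂ) * I)).re < -η :=
      hg_t.eventually (gt_mem_nhds (by rw [hη]; linarith))
    have hE : Tendsto (fun t : ℝ => Real.exp (-(L * Real.log t))) (𝓝[>] 0) atTop := by
      refine Real.tendsto_exp_atTop.comp ?_
      have : Tendsto (fun t : ℝ => Real.log t * (-L)) (𝓝[>] 0) atTop :=
        Real.tendsto_log_nhdsGT_zero.atBot_mul_const_of_neg (by linarith)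
      exact this.congr fun t => by ring
    have hE_ev : ∀ᶠ t in 𝓝[>] (0 : ℝ), M / η < Real.exp (-(L * Real.log t)) :=
      hE.eventually (eventually_gt_atTop _)
    have hpos_t : ∀ᶠ t in 𝓝[>] (0 : ℝ), 0 < t := self_mem_nhdsWithin
    obtain ⟨t, ht0, htU, hrept, hgt, hEt⟩ :=
      (hpos_t.and (hzt_U.and (hrep_t.and (hg_ev.and hE_ev)))).exists
    -- evaluate the half-plane functional at `zt t`
    have hval : (starRingEnd ℂ) ω * ((zt t - x) ^ (-(1 / 4 : ℂ)) * G (zt t)) =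
        ((Real.exp (-(L * Real.log t)) : ℝ) : ℂ) *
          ((starRingEnd ℂ) ω * g (zt t) * exp (-(((L * θ : ℝ)) : ℂ) * I)) := by
      rw [hrept, hm, smul_eq_mul, hzt_sub, hL]
      exact ray_leading_term ht0 (by linarith) hθπ.le m ω (g (zt t))
    have h1 := hhalf (zt t) htU
    rw [hval, Complex.re_ofReal_mul] at h1
    -- `-M ≤ E * ρ` with `E > M/η > 0`... and `ρ < -η`: contradiction
    have hEpos : 0 < Real.exp (-(L * Real.log t)) := Real.exp_pos _
    have h2 : Real.exp (-(L * Real.log t)) *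
        ((starRingEnd ℂ) ω * g (zt t) * exp (-(((L * θ : ℝ)) : ℂ) * I)).re <
        Real.exp (-(L * Real.log t)) * (-η) := mul_lt_mul_of_pos_left hgt hEpos
    have h3 : M < Real.exp (-(L * Real.log t)) * η := by
      rw [div_lt_iff₀ hη0] at hEt; linarith
    linarith
  -- (4) order zero: removable singularity with nonzero value
  have hn0 : n = 0 := le_antisymm hn_nonpos hn_nonneg
  refine ⟨g, hg, hg0, ?_⟩
  filter_upwards [hrep] with z hz
  rw [hz, hn0, zpow_zero, one_smul]

/-- **The blow-up coefficient at the root.** If `G` agrees near `x` (punctured) with `g`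
analytic at `x`, then `φ(w) = (w - x)^{-1/4} G(w)` satisfies `φ'(z) (z - x)^{5/4} → -g(x)/4` as
`z → x` through `{im z > im x}` (`φ' = -¼ (z-x)^{-5/4} G + (z-x)^{-1/4} G'`, `(z - x) G' → 0`);
with `h - p = e^{iθ} φ`, `g_lim = α⁻¹ h'`: `g_lim (z - x)^{5/4} → -e^{iθ} g(x)/(4α)`. [folklore] -/
theorem tendsto_deriv_mul_cpow_five_fourths {x : ℂ} {G g : ℂ → ℂ} (hg : AnalyticAt ℂ g x)
    (hGg : G =ᶠ[𝓝[≠] x] g) :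
    Tendsto (fun z => deriv (fun w => (w - x) ^ (-(1 / 4 : ℂ)) * G w) z * (z - x) ^ ((5 : ℂ) / 4))
      (𝓝[{z : ℂ | x.im < z.im}] x) (𝓝 (-(g x) / 4)) := by
  -- a ball on which `g` is analytic and `G = g` off the centre
  obtain ⟨ε, hε, hball⟩ := hg.exists_ball_analyticOnNhd
  obtain ⟨ε', hε', hGg'⟩ : ∃ ε' > 0, ∀ z ∈ ball x ε', z ≠ x → G z = g z := by
    have h := (eventually_nhdsWithin_iff.1 hGg)
    obtain ⟨ε', hε', h'⟩ := Metric.eventually_nhds_iff_ball.1 h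
    exact ⟨ε', hε', fun z hz hzx => h' z hz hzx⟩
  set ρ : ℝ := min ε ε' with hρ
  have hρ0 : 0 < ρ := lt_min hε hε'
  -- the derivative formula on `{im > im x} ∩ ball x ρ`
  have hformula : ∀ z ∈ {z : ℂ | x.im < z.im} ∩ ball x ρ,
      deriv (fun w => (w - x) ^ (-(1 / 4 : ℂ)) * G w) z * (z - x) ^ ((5 : ℂ) / 4) =
        -(1 / 4 : ℂ) * g z + deriv g z * (z - x) := by
    rintro z ⟨hzim, hzρ⟩
    have hzim' : 0 < (z - x).im := by simp only [sub_im]; linarith [show x.im < z.im from hzim]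
    have hzx : z - x ≠ 0 := by
      intro h; rw [h] at hzim'; simp at hzim'
    have hzx' : z ≠ x := sub_ne_zero.1 hzx
    have hslit : z - x ∈ slitPlane := mem_slitPlane_iff.2 (Or.inr hzim'.ne')
    have hzε : z ∈ ball x ε := ball_subset_ball (min_le_left _ _) hzρ
    have hzε' : z ∈ ball x ε' := ball_subset_ball (min_le_right _ _) hzρ
    -- `G = g` near `z`
    have hopen : IsOpen (ball x ρ \ {x}) := isOpen_ball.sdiff isClosed_singleton
    have hGg_z : G =ᶠ[𝓝 z] g := by
      filter_upwards [hopen.mem_nhds ⟨hzρ, hzx'⟩] with w hw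
      exact hGg' w (ball_subset_ball (min_le_right _ _) hw.1) hw.2
    have hφ_eq : (fun w => (w - x) ^ (-(1 / 4 : ℂ)) * G w) =ᶠ[𝓝 z]
        fun w => (w - x) ^ (-(1 / 4 : ℂ)) * g w := by
      filter_upwards [hGg_z] with w hw
      rw [hw]
    rw [hφ_eq.deriv_eq]
    -- product rule with the principal-branch power
    have hgd : HasDerivAt g (deriv g z) z := (hball z hzε).differentiableAt.hasDerivAt
    have hpow : HasDerivAt (fun w : ℂ => (w - x) ^ (-(1 / 4 : ℂ)))
        (-(1 / 4 : ℂ) * (z - x) ^ (-(1 / 4 : ℂ) - 1) * 1) z :=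
      ((hasDerivAt_id z).sub_const x).cpow_const hslit
    have hprod : HasDerivAt (fun w => (w - x) ^ (-(1 / 4 : ℂ)) * g w)
        (-(1 / 4 : ℂ) * (z - x) ^ (-(1 / 4 : ℂ) - 1) * 1 * g z +
          (z - x) ^ (-(1 / 4 : ℂ)) * deriv g z) z := hpow.mul hgd
    rw [hprod.deriv]
    have h1 : (z - x) ^ (-(1 / 4 : ℂ) - 1) * (z - x) ^ ((5 : ℂ) / 4) = 1 := by
      rw [← cpow_add _ _ hzx, show -(1 / 4 : ℂ) - 1 + 5 / 4 = 0 by norm_num, cpow_zero]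
    have h2 : (z - x) ^ (-(1 / 4 : ℂ)) * (z - x) ^ ((5 : ℂ) / 4) = z - x := by
      rw [← cpow_add _ _ hzx, show -(1 / 4 : ℂ) + 5 / 4 = 1 by norm_num, cpow_one]
    calc (-(1 / 4 : ℂ) * (z - x) ^ (-(1 / 4 : ℂ) - 1) * 1 * g z +
          (z - x) ^ (-(1 / 4 : ℂ)) * deriv g z) * (z - x) ^ ((5 : ℂ) / 4)
        = -(1 / 4 : ℂ) * g z * ((z - x) ^ (-(1 / 4 : ℂ) - 1) * (z - x) ^ ((5 : ℂ) / 4)) +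
            deriv g z * ((z - x) ^ (-(1 / 4 : ℂ)) * (z - x) ^ ((5 : ℂ) / 4)) := by ring
      _ = -(1 / 4 : ℂ) * g z + deriv g z * (z - x) := by rw [h1, h2, mul_one]
  -- the right-hand side is continuous at `x` with value `-g(x)/4`
  have hcont : Tendsto (fun z => -(1 / 4 : ℂ) * g z + deriv g z * (z - x)) (𝓝 x)
      (𝓝 (-(1 / 4 : ℂ) * g x + deriv g x * (x - x))) :=
    (tendsto_const_nhds.mul hg.continuousAt.tendsto).add
      (hg.deriv.continuousAt.tendsto.mul (tendsto_id.sub tendsto_const_nhds))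
  rw [sub_self, mul_zero, add_zero, show -(1 / 4 : ℂ) * g x = -(g x) / 4 by ring] at hcont
  refine (hcont.mono_left nhdsWithin_le_nhds).congr' ?_
  have hmem : {z : ℂ | x.im < z.im} ∩ ball x ρ ∈ 𝓝[{z : ℂ | x.im < z.im}] x :=
    inter_mem_nhdsWithin _ (ball_mem_nhds x hρ0)
  filter_upwards [hmem] with z hz
  exact (hformula z hz).symm

/-- **Root order `5/4` (export form, registered sub-goal `pickEngine_rootOrder` of stub
`stub_pickEngine`).** For `G` meromorphic at the pinned root `x` such that `φ = (· - x)^{-1/4} G`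
maps the upper half-disc `{im z > im x} ∩ B(x, r)` into a closed half-plane `{w | -M ≤ re (ω̄ w)}`
(`|ω| = 1`) and is unbounded at `x` from inside it, there is `c ≠ 0` with `G → c` at `x` and
`φ'(z) (z - x)^{5/4} → -c/4` through `{im z > im x}` — STAGE 2 at the root GIVEN the two-arm
reflection producing `G` and the exclusion of an essential singularity. [folklore] -/
theorem pickEngine_rootOrder :
    ∀ (x ω : ℂ) (r M : ℝ) (G : ℂ → ℂ), 0 < r → ‖ω‖ = 1 → MeromorphicAt G x →
      (∀ z ∈ {z : ℂ | x.im < z.im} ∩ Metric.ball x r,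
        -M ≤ ((starRingEnd ℂ) ω * ((z - x) ^ (-(1 / 4 : ℂ)) * G z)).re) →
      (∀ A : ℝ, ∃ᶠ z in 𝓝[{z : ℂ | x.im < z.im} ∩ Metric.ball x r] x,
        A ≤ ‖(z - x) ^ (-(1 / 4 : ℂ)) * G z‖) →
      ∃ c : ℂ, c ≠ 0 ∧ Filter.Tendsto G (𝓝[≠] x) (𝓝 c) ∧
        Filter.Tendsto (fun z => deriv (fun w => (w - x) ^ (-(1 / 4 : ℂ)) * G w) z *
          (z - x) ^ ((5 : ℂ) / 4)) (𝓝[{z : ℂ | x.im < z.im}] x) (𝓝 (-c / 4)) := by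
  intro x ω r M G hr hω hmer hhalf hdiv
  obtain ⟨g, hg, hg0, hGg⟩ := root_order_of_meromorphicAt hmer hhalf hω hr hdiv
  refine ⟨g x, hg0, ?_, ?_⟩
  · exact (hg.continuousAt.tendsto.mono_left nhdsWithin_le_nhds).congr' hGg.symm
  · have := tendsto_deriv_mul_cpow_five_fourths hg hGg
    rwa [show -(g x) / 4 = -g x / 4 from rfl] at this

end Summit.CriticalPhenomena.SAWScalingLimit.Theorems.PickHalfPlane.Engine

end
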